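import Literature.Topology.FourManifolds.TautFoliationsVertexSectors
import Literature.Topology.FourManifolds.TautFoliationsConePunctures
import HarnessLib

/-!
# The common height at an interior vertex of a disc in checkerboard cone position

Topic: sequel to `TautFoliationsVertexSectors.lean` and `TautFoliationsConePunctures.lean`. At an
interior vertex `v` of the grid of a cone position `P`, the four squares `Q_j^U` ("upper square
of the sector `j`", centre `v + Rʲ(ℓ, ℓ)`; the lower square of the sector `j + 1`) all contain
`v`, are pairwise adjacent, and the filled map sends them into the source of the flow box of
`Q₀ = Q_0^U`. The **common height** `Hv z = h_{e_{Q₀}} (fill z) - h_{e_{Q₀}} (fill v)` is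
continuous near `v`, and, by the transverse orientation of the foliation (the changes of flow
box are locally increasing in the height), it is a strictly increasing function of the cone
height of each of the four squares on a neighbourhood of `v`. Along every broken ray of every
sector (on which the cone heights are affine, `coneHt_spt_upper` / `_lower`) it is therefore
**strictly monotone**, with the sign `s_j = ±1` of the sector (roof/floor of `Q_j^U`) chosen so
that it increases with the signed ordinate: the transversal structure of the four-prong saddle
at `v`.

* `ConePosition.qU`, `ConePosition.qL`, `ConePosition.centre_qU`, `ConePosition.qL_add_one`
  (**definitions** / **proved**);
* `ConePosition.Hv` (**definition**), `ConePosition.Hv_self`, `ConePosition.exists_vertexRadius`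
  (**proved**: a radius `r` with continuity of `Hv` on `closedBall v r` and the increasing
  correspondence `coneHt_Q z < coneHt_Q z' ↔ Hv z < Hv z'` for each of the four squares);
* `ConePosition.sgn` (**definition**: the sign of a sector), `ConePosition.sgn_add_one`;
* `ConePosition.strictMonoOn_Hv_spt` (**proved**): strict monotonicity along the broken rays;
  `ConePosition.Hv_spt_axis_pos` / `_neg` (**proved**): signs on the half axes.

All statements are [folklore].
-/

noncomputable section

open Set Filter Metric Function
open scoped Topology

namespace Literature.Topology.FourManifolds

namespace Foliation.ConePosition

open ConeSquare SquareGrid VertexSector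

variable {B : Type*} [NormedAddCommGroup B] {M : Type*} [TopologicalSpace M]
  {F : Foliation B M} {f : ℝ × ℝ → M} {c₀ : ℝ × ℝ} {L : ℝ} {hL : 0 < L} (P : ConePosition F f c₀ hL)
  {v : ℝ × ℝ} (hv : v ∈ P.gr.vertices) (hvb : v ∈ ball P.gr.bigCentre (P.gr.n * P.gr.ℓ))

/-! ## The four squares at the vertex -/

/-- Centres determine the squares. [folklore] -/
theorem centre_injective : Injective P.gr.centre := by
  intro q q' h
  have hℓ := P.gr.hℓ
  have h₁ := congrArg Prod.fst h
  have h₂ := congrArg Prod.snd h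
  rw [Grid.centre_fst, Grid.centre_fst] at h₁
  rw [Grid.centre_snd, Grid.centre_snd] at h₂
  have e₁ : ((q.1 : ℕ) : ℝ) = (q'.1 : ℕ) := by nlinarith
  have e₂ : ((q.2 : ℕ) : ℝ) = (q'.2 : ℕ) := by nlinarith
  exact Prod.ext (Fin.ext (by exact_mod_cast e₁)) (Fin.ext (by exact_mod_cast e₂))

/-- The signs of `Rz j (1, 1)`. [folklore] -/
theorem exists_isSign_Rz (j : ZMod 4) (t : ℝ) (ht : IsSign t) :
    ∃ σ₁ σ₂ : ℝ, IsSign σ₁ ∧ IsSign σ₂ ∧ Rz j (1, t) = (σ₁, σ₂) := by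
  have h1 : IsSign (1 : ℝ) := Or.inl rfl
  have hn : ∀ {a : ℝ}, IsSign a → IsSign (-a) := fun {a} ha ↦ by
    rcases ha with rfl | rfl
    · exact Or.inr rfl
    · exact Or.inl (by norm_num)
  fin_cases j
  · exact ⟨1, t, h1, ht, by show Rz 0 (1, t) = (1, t); rw [Rz_zero]⟩
  · refine ⟨-t, 1, hn ht, h1, ?_⟩
    show Rz 1 (1, t) = (-t, 1)
    rw [Rz_one]
  · refine ⟨-1, -t, hn h1, hn ht, ?_⟩
    show Rz 2 (1, t) = (-1, -t)
    rw [Rz_two]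
  · refine ⟨t, -1, ht, hn h1, ?_⟩
    show Rz 3 (1, t) = (t, -1)
    rw [Rz_three]

include hv hvb in
/-- A square with centre `v + Rz j (ℓ, t ℓ)`, `t = ±1`, exists. [folklore] -/
theorem exists_centre_eq (j : ZMod 4) {t : ℝ} (ht : IsSign t) :
    ∃ q : Fin P.n × Fin P.n, P.gr.centre q = v + Rz j (P.gr.ℓ, t * P.gr.ℓ) := by
  obtain ⟨σ₁, σ₂, h₁, h₂, hR⟩ := exists_isSign_Rz j t ht
  obtain ⟨q, hq⟩ := P.gr.exists_sq_of_mem_vertices hv hvb h₁ h₂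
  refine ⟨q, ?_⟩
  rw [hq, show ((P.gr.ℓ, t * P.gr.ℓ) : ℝ × ℝ) = P.gr.ℓ • ((1, t) : ℝ × ℝ) by ext <;> simp [mul_comm], map_smul, hR]
  ext <;> simp [mul_comm]

/-- **The upper square of the sector `j`** at `v`. [folklore] -/
def qU (j : ZMod 4) : Fin P.n × Fin P.n := (P.exists_centre_eq hv hvb j (t := 1) (Or.inl rfl)).choose

/-- **The lower square of the sector `j`** at `v`. [folklore] -/
def qL (j : ZMod 4) : Fin P.n × Fin P.n := (P.exists_centre_eq hv hvb j (t := -1) (Or.inr rfl)).choose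

/-- The centre of the upper square. [folklore] -/
theorem centre_qU (j : ZMod 4) : P.gr.centre (P.qU hv hvb j) = cU v P.gr.ℓ j :=
  (P.exists_centre_eq hv hvb j (t := 1) (Or.inl rfl)).choose_spec.trans (by rw [one_mul]; rfl)

/-- The centre of the lower square. [folklore] -/
theorem centre_qL (j : ZMod 4) : P.gr.centre (P.qL hv hvb j) = cL v P.gr.ℓ j :=
  (P.exists_centre_eq hv hvb j (t := -1) (Or.inr rfl)).choose_spec.trans (by rw [neg_one_mul]; rfl)

/-- **The lower square of the sector `j + 1` is the upper square of the sector `j`.**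
[folklore] -/
theorem qL_add_one (j : ZMod 4) : P.qL hv hvb (j + 1) = P.qU hv hvb j :=
  P.centre_injective (by rw [centre_qU, centre_qL, cL_add_one])

/-- `v` lies in the upper square. [folklore] -/
theorem mem_sq_qU (j : ZMod 4) : v ∈ P.gr.sq (P.qU hv hvb j) := by
  have hℓ := P.gr.hℓ
  rw [Grid.sq, mem_closedBall, centre_qU, cU, dist_comm, dist_eq_norm, add_sub_cancel_left, norm_Rz, Prod.norm_mk,
    Real.norm_of_nonneg hℓ.le, max_self]

/-- `v` lies in the lower square. [folklore] -/
theorem mem_sq_qL (j : ZMod 4) : v ∈ P.gr.sq (P.qL hv hvb j) := by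
  have hℓ := P.gr.hℓ
  rw [Grid.sq, mem_closedBall, centre_qL, cL, dist_comm, dist_eq_norm, add_sub_cancel_left, norm_Rz, Prod.norm_mk,
    Real.norm_of_nonneg hℓ.le, norm_neg, Real.norm_of_nonneg hℓ.le, max_self]

/-- The base square: the upper square of the sector `0`. [folklore] -/
def q₀ : Fin P.n × Fin P.n := P.qU hv hvb 0

/-- The squares at `v` are adjacent to the base square. [folklore] -/
theorem adj_qU (j : ZMod 4) : P.gr.Adj (P.qU hv hvb j) (P.q₀ hv hvb) :=
  P.gr.adj_of_inter_nonempty ⟨v, P.mem_sq_qU hv hvb j, P.mem_sq_qU hv hvb 0⟩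

/-- The squares at `v` are adjacent to the base square. [folklore] -/
theorem adj_qL (j : ZMod 4) : P.gr.Adj (P.qL hv hvb j) (P.q₀ hv hvb) :=
  P.gr.adj_of_inter_nonempty ⟨v, P.mem_sq_qL hv hvb j, P.mem_sq_qU hv hvb 0⟩

/-! ## The common height -/

variable [NormedSpace ℝ B]

/-- **The common height at `v`**: the height in the box of the base square of the filled map,
normalised to `0` at `v`. [folklore] -/
def Hv (z : ℝ × ℝ) : ℝ :=
  height (P.box (P.q₀ hv hvb)) (P.fill P.apex z) - height (P.box (P.q₀ hv hvb)) (P.fill P.apex v)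

/-- `Hv v = 0`. [folklore] -/
@[simp] theorem Hv_self : P.Hv hv hvb v = 0 := sub_self _

/-- Points of the upper square are sent into the source of the base box. [folklore] -/
theorem fill_mem_source_qU {j : ZMod 4} {z : ℝ × ℝ} (hz : z ∈ P.gr.sq (P.qU hv hvb j)) :
    P.fill P.apex z ∈ (P.box (P.q₀ hv hvb)).source :=
  P.fill_mem_source_of_adj P.apex_spec.1 (P.adj_qU hv hvb j) hz

/-- Points of the lower square are sent into the source of the base box. [folklore] -/
theorem fill_mem_source_qL {j : ZMod 4} {z : ℝ × ℝ} (hz : z ∈ P.gr.sq (P.qL hv hvb j)) :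
    P.fill P.apex z ∈ (P.box (P.q₀ hv hvb)).source :=
  P.fill_mem_source_of_adj P.apex_spec.1 (P.adj_qL hv hvb j) hz

/-- Points of the upper square are sent into the source of its own box. [folklore] -/
theorem fill_mem_source_qU' {j : ZMod 4} {z : ℝ × ℝ} (hz : z ∈ P.gr.sq (P.qU hv hvb j)) :
    P.fill P.apex z ∈ (P.box (P.qU hv hvb j)).source :=
  P.fill_mem_source P.apex_spec.1 hz

/-- Points of the lower square are sent into the source of its own box. [folklore] -/
theorem fill_mem_source_qL' {j : ZMod 4} {z : ℝ × ℝ} (hz : z ∈ P.gr.sq (P.qL hv hvb j)) :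
    P.fill P.apex z ∈ (P.box (P.qL hv hvb j)).source :=
  P.fill_mem_source P.apex_spec.1 hz

omit [NormedSpace ℝ B] in
/-- **Points within `ℓ` of `v` (max norm, closed) lie in one of the four squares at `v`**, namely
in the upper or lower square of the sector `0` or `2` according to the signs of the coordinates.
We only need: every point of `closedBall v ℓ` lies in `sq (qU j)` or `sq (qL j)` for some `j`.
[folklore] -/
theorem exists_mem_sq_of_mem_closedBall {z : ℝ × ℝ} (hz : z ∈ closedBall v P.gr.ℓ) :
    ∃ j, z ∈ P.gr.sq (P.qU hv hvb j) ∨ z ∈ P.gr.sq (P.qL hv hvb j) := by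
  have hℓ := P.gr.hℓ
  rw [mem_closedBall, Prod.dist_eq, Real.dist_eq, Real.dist_eq, max_le_iff] at hz
  obtain ⟨h₁, h₂⟩ := hz
  rw [abs_le] at h₁ h₂
  -- squares as closed balls about `v + (±ℓ, ±ℓ)`
  have key : ∀ (a b : ℝ), |z.1 - (v.1 + a)| ≤ P.gr.ℓ → |z.2 - (v.2 + b)| ≤ P.gr.ℓ →
      z ∈ closedBall (v + (a, b)) P.gr.ℓ := fun a b ha hb ↦ by
    rw [mem_closedBall, Prod.dist_eq, Real.dist_eq, Real.dist_eq]; exact max_le ha hb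
  by_cases hx : 0 ≤ z.1 - v.1
  · by_cases hy : 0 ≤ z.2 - v.2
    · refine ⟨0, Or.inl ?_⟩
      rw [Grid.sq, centre_qU, cU, Rz_zero]
      exact key _ _ (abs_le.2 ⟨by linarith, by linarith⟩) (abs_le.2 ⟨by linarith, by linarith⟩)
    · refine ⟨0, Or.inr ?_⟩
      rw [Grid.sq, centre_qL, cL, Rz_zero]
      push Not at hy
      exact key _ _ (abs_le.2 ⟨by linarith, by linarith⟩) (abs_le.2 ⟨by linarith, by linarith⟩)
  · push Not at hx
    by_cases hy : 0 ≤ z.2 - v.2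
    · refine ⟨2, Or.inr ?_⟩
      rw [Grid.sq, centre_qL, cL, Rz_two, neg_neg]
      exact key (-P.gr.ℓ) P.gr.ℓ (abs_le.2 ⟨by linarith, by linarith⟩) (abs_le.2 ⟨by linarith, by linarith⟩)
    · refine ⟨2, Or.inl ?_⟩
      rw [Grid.sq, centre_qU, cU, Rz_two]
      push Not at hy
      exact key (-P.gr.ℓ) (-P.gr.ℓ) (abs_le.2 ⟨by linarith, by linarith⟩) (abs_le.2 ⟨by linarith, by linarith⟩)

/-- Points within `ℓ` of `v` are sent into the source of the base box. [folklore] -/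
theorem fill_mem_source_of_mem_closedBall {z : ℝ × ℝ} (hz : z ∈ closedBall v P.gr.ℓ) :
    P.fill P.apex z ∈ (P.box (P.q₀ hv hvb)).source := by
  obtain ⟨j, h | h⟩ := P.exists_mem_sq_of_mem_closedBall hv hvb hz
  · exact P.fill_mem_source_qU hv hvb h
  · exact P.fill_mem_source_qL hv hvb h

omit [NormedSpace ℝ B] in
/-- A closed ball about `v` of radius less than the gap lies in the open big ball. [folklore] -/
theorem closedBall_subset_bigBall {r : ℝ} (hr : r < P.gr.n * P.gr.ℓ - dist v P.gr.bigCentre) :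
    closedBall v r ⊆ ball P.gr.bigCentre (P.gr.n * P.gr.ℓ) := fun z hz ↦ by
  rw [mem_ball]
  calc dist z P.gr.bigCentre ≤ dist z v + dist v P.gr.bigCentre := dist_triangle _ _ _
    _ < P.gr.n * P.gr.ℓ := by rw [mem_closedBall] at hz; linarith

/-- **Continuity of the common height near `v`.** [folklore] -/
theorem continuousOn_Hv {r : ℝ} (hrℓ : r ≤ P.gr.ℓ) (hr : r < P.gr.n * P.gr.ℓ - dist v P.gr.bigCentre) :
    ContinuousOn (P.Hv hv hvb) (closedBall v r) := by
  intro z hz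
  have hzb : z ∈ ball P.gr.bigCentre (P.gr.n * P.gr.ℓ) := P.closedBall_subset_bigBall hr hz
  have hsrc : P.fill P.apex z ∈ (P.box (P.q₀ hv hvb)).source :=
    P.fill_mem_source_of_mem_closedBall hv hvb (closedBall_subset_closedBall hrℓ hz)
  have h1 : ContinuousAt (fun z ↦ height (P.box (P.q₀ hv hvb)) (P.fill P.apex z)) z :=
    (continuousAt_height hsrc).comp (P.continuousAt_fill hzb)
  exact (h1.sub continuousAt_const).continuousWithinAt

/-! ## Increasing correspondences of heights near `fill v` -/

/-- **Near `fill v`, the box of a square at `v` and the base box induce the same strict order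
of heights** (transverse orientation, applied both ways). [folklore] -/
theorem exists_nhds_height_lt_iff (ho : F.IsTransverselyOriented) {q : Fin P.n × Fin P.n} (hq : v ∈ P.gr.sq q) :
    ∃ U ∈ 𝓝 (P.fill P.apex v), ∀ m₁ ∈ U, ∀ m₂ ∈ U, m₁ ∈ (P.box q).source → m₂ ∈ (P.box q).source →
      m₁ ∈ (P.box (P.q₀ hv hvb)).source → m₂ ∈ (P.box (P.q₀ hv hvb)).source →
      (height (P.box q) m₁ < height (P.box q) m₂ ↔
        height (P.box (P.q₀ hv hvb)) m₁ < height (P.box (P.q₀ hv hvb)) m₂) := by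
  set x := P.fill P.apex v with hx
  have hxq : x ∈ (P.box q).source := P.fill_mem_source P.apex_spec.1 hq
  have hx₀ : x ∈ (P.box (P.q₀ hv hvb)).source := P.fill_mem_source P.apex_spec.1 (P.mem_sq_qU hv hvb 0)
  obtain ⟨U₁, hU₁, h₁⟩ := ho _ (P.box_mem q) _ (P.box_mem (P.q₀ hv hvb)) x ⟨hxq, hx₀⟩
  obtain ⟨U₂, hU₂, h₂⟩ := ho _ (P.box_mem (P.q₀ hv hvb)) _ (P.box_mem q) x ⟨hx₀, hxq⟩
  refine ⟨U₁ ∩ U₂, inter_mem hU₁ hU₂, fun m₁ hm₁ m₂ hm₂ hq₁ hq₂ h0₁ h0₂ ↦ ⟨fun h ↦ ?_, fun h ↦ ?_⟩⟩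
  · exact h₁ m₁ ⟨hm₁.1, hq₁, h0₁⟩ m₂ ⟨hm₂.1, hq₂, h0₂⟩ h
  · exact h₂ m₁ ⟨hm₁.2, h0₁, hq₁⟩ m₂ ⟨hm₂.2, h0₂, hq₂⟩ h

/-- **A vertex radius**: `r ∈ (0, ℓ]`, inside the gap, such that `fill` maps `closedBall v r`
into a neighbourhood of `fill v` on which, for each of the eight squares `qU j`, `qL j`, the
heights of its box and of the base box are in increasing correspondence. [folklore] -/
theorem exists_vertexRadius (ho : F.IsTransverselyOriented) :
    ∃ r ∈ Ioc 0 P.gr.ℓ, r < P.gr.n * P.gr.ℓ - dist v P.gr.bigCentre ∧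
      ∀ j, (∀ z ∈ closedBall v r ∩ P.gr.sq (P.qU hv hvb j), ∀ z' ∈ closedBall v r ∩ P.gr.sq (P.qU hv hvb j),
          (height (P.box (P.qU hv hvb j)) (P.fill P.apex z) < height (P.box (P.qU hv hvb j)) (P.fill P.apex z') ↔
            P.Hv hv hvb z < P.Hv hv hvb z')) ∧
        (∀ z ∈ closedBall v r ∩ P.gr.sq (P.qL hv hvb j), ∀ z' ∈ closedBall v r ∩ P.gr.sq (P.qL hv hvb j),
          (height (P.box (P.qL hv hvb j)) (P.fill P.apex z) < height (P.box (P.qL hv hvb j)) (P.fill P.apex z') ↔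
            P.Hv hv hvb z < P.Hv hv hvb z')) := by
  have hℓ := P.gr.hℓ
  have hgap : 0 < P.gr.n * P.gr.ℓ - dist v P.gr.bigCentre := by have := mem_ball.1 hvb; linarith
  -- the neighbourhoods for the eight squares
  choose U hU hUiff using fun q : {q // v ∈ P.gr.sq q} ↦ P.exists_nhds_height_lt_iff hv hvb ho q.2
  set qs : Finset {q // v ∈ P.gr.sq q} :=
    (Finset.univ.image fun j : ZMod 4 ↦ (⟨P.qU hv hvb j, P.mem_sq_qU hv hvb j⟩ : {q // v ∈ P.gr.sq q})) ∪
    (Finset.univ.image fun j : ZMod 4 ↦ (⟨P.qL hv hvb j, P.mem_sq_qL hv hvb j⟩ : {q // v ∈ P.gr.sq q})) with hqs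
  set W : Set M := ⋂ q ∈ qs, U q with hW
  have hWn : W ∈ 𝓝 (P.fill P.apex v) := (Filter.biInter_finset_mem qs).2 fun q _ ↦ hU q
  -- pull back by `fill`
  have hcont : ContinuousAt (P.fill P.apex) v := P.continuousAt_fill hvb
  obtain ⟨δ, hδ, hball⟩ := Metric.mem_nhds_iff.1 (hcont.preimage_mem_nhds hWn)
  set r := min (δ / 2) (min P.gr.ℓ ((P.gr.n * P.gr.ℓ - dist v P.gr.bigCentre) / 2)) with hr
  have hrpos : 0 < r := lt_min (by linarith) (lt_min hℓ (by linarith))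
  have hrδ : r < δ := (min_le_left _ _).trans_lt (by linarith)
  have hrℓ : r ≤ P.gr.ℓ := (min_le_right _ _).trans (min_le_left _ _)
  have hrgap : r < P.gr.n * P.gr.ℓ - dist v P.gr.bigCentre :=
    ((min_le_right _ _).trans (min_le_right _ _)).trans_lt (by linarith)
  have hfillW : ∀ z ∈ closedBall v r, P.fill P.apex z ∈ W := fun z hz ↦
    hball (mem_ball.2 ((mem_closedBall.1 hz).trans_lt hrδ))
  have hWU : ∀ q ∈ qs, W ⊆ U q := fun q hq ↦ biInter_subset_of_mem hq
  refine ⟨r, ⟨hrpos, hrℓ⟩, hrgap, fun j ↦ ⟨fun z hz z' hz' ↦ ?_, fun z hz z' hz' ↦ ?_⟩⟩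
  · set q : {q // v ∈ P.gr.sq q} := ⟨P.qU hv hvb j, P.mem_sq_qU hv hvb j⟩
    have hqmem : q ∈ qs := Finset.mem_union_left _ (Finset.mem_image.2 ⟨j, Finset.mem_univ _, rfl⟩)
    have h := hUiff q _ (hWU q hqmem (hfillW z hz.1)) _ (hWU q hqmem (hfillW z' hz'.1))
      (P.fill_mem_source_qU' hv hvb hz.2) (P.fill_mem_source_qU' hv hvb hz'.2)
      (P.fill_mem_source_qU hv hvb hz.2) (P.fill_mem_source_qU hv hvb hz'.2)
    rw [h, Hv, Hv]
    exact sub_lt_sub_iff_right _ |>.symm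
  · set q : {q // v ∈ P.gr.sq q} := ⟨P.qL hv hvb j, P.mem_sq_qL hv hvb j⟩
    have hqmem : q ∈ qs := Finset.mem_union_right _ (Finset.mem_image.2 ⟨j, Finset.mem_univ _, rfl⟩)
    have h := hUiff q _ (hWU q hqmem (hfillW z hz.1)) _ (hWU q hqmem (hfillW z' hz'.1))
      (P.fill_mem_source_qL' hv hvb hz.2) (P.fill_mem_source_qL' hv hvb hz'.2)
      (P.fill_mem_source_qL hv hvb hz.2) (P.fill_mem_source_qL hv hvb hz'.2)
    rw [h, Hv, Hv]
    exact sub_lt_sub_iff_right _ |>.symm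

/-! ## The sign of a sector and strict monotonicity along the broken rays -/

/-- **The sign of the sector `j`**: `1` if its upper square is a roof square, `-1` if a floor
square. [folklore] -/
def sgn (j : ZMod 4) : ℝ := by classical exact if P.roofPat (P.qU hv hvb j) then 1 else -1

omit [NormedSpace ℝ B] in
/-- The sign is a sign. [folklore] -/
theorem isSg_sgn (j : ZMod 4) : IsSg (P.sgn hv hvb j) := by
  classical
  unfold sgn; split_ifs
  · exact Or.inl rfl
  · exact Or.inr rfl

omit [NormedSpace ℝ B] in
/-- The upper and the lower square of a sector are edge neighbours' parity mates: their patterns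
are opposite. [folklore] -/
theorem roofPat_qL_iff (j : ZMod 4) : P.roofPat (P.qL hv hvb j) ↔ ¬ P.roofPat (P.qU hv hvb j) := by
  -- the centres differ by `Rz j (0, 2ℓ)`; the index sum differs by an odd number
  have hℓ := P.gr.hℓ
  have hU := P.centre_qU hv hvb j
  have hL := P.centre_qL hv hvb j
  rw [cU] at hU
  rw [cL] at hL
  -- coordinates of the centres
  have key : ∀ (q q' : Fin P.n × Fin P.n) (a b : ℝ), IsSign a → IsSign b →
      P.gr.centre q - P.gr.centre q' = (a * P.gr.ℓ + b * P.gr.ℓ, a * P.gr.ℓ - b * P.gr.ℓ) ∨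
      P.gr.centre q - P.gr.centre q' = (a * P.gr.ℓ - b * P.gr.ℓ, a * P.gr.ℓ + b * P.gr.ℓ) →
      (P.roofPat q ↔ ¬ P.roofPat q') := by
    intro q q' a b ha hb h
    have e₁ : ((P.gr.centre q).1 - (P.gr.centre q').1) = 2 * ((q.1 : ℕ) - (q'.1 : ℕ) : ℝ) * P.gr.ℓ := by
      rw [Grid.centre_fst, Grid.centre_fst]; ring
    have e₂ : ((P.gr.centre q).2 - (P.gr.centre q').2) = 2 * ((q.2 : ℕ) - (q'.2 : ℕ) : ℝ) * P.gr.ℓ := by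
      rw [Grid.centre_snd, Grid.centre_snd]; ring
    -- the differences of indices are `(a ± b)/2`, of which exactly one is odd... we compute parities
    have hsum : ∃ k : ℤ, ((q.1 : ℕ) : ℤ) + (q.2 : ℕ) - ((q'.1 : ℕ) + (q'.2 : ℕ)) = 2 * k + 1 ∨
        ((q.1 : ℕ) : ℤ) + (q.2 : ℕ) - ((q'.1 : ℕ) + (q'.2 : ℕ)) = 2 * k - 1 := by
      rcases h with h | h
      · have h1 := congrArg Prod.fst h
        have h2 := congrArg Prod.snd h
        simp only [Prod.fst_sub, Prod.snd_sub] at h1 h2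
        rw [e₁] at h1
        rw [e₂] at h2
        -- `2 (q.1 - q'.1) = a + b`, `2 (q.2 - q'.2) = a - b`, so the index sum differs by `a`
        have hs : ((q.1 : ℕ) : ℝ) - q'.1 + ((q.2 : ℕ) - q'.2) = a := by nlinarith
        rcases ha with rfl | rfl
        · refine ⟨0, Or.inl ?_⟩
          have : ((q.1 : ℕ) : ℝ) + q.2 - (q'.1 + q'.2) = 1 := by linarith
          exact_mod_cast this
        · refine ⟨0, Or.inr ?_⟩
          have : ((q.1 : ℕ) : ℝ) + q.2 - (q'.1 + q'.2) = -1 := by linarith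
          exact_mod_cast this
      · have h1 := congrArg Prod.fst h
        have h2 := congrArg Prod.snd h
        simp only [Prod.fst_sub, Prod.snd_sub] at h1 h2
        rw [e₁] at h1
        rw [e₂] at h2
        have hs : ((q.1 : ℕ) : ℝ) - q'.1 + ((q.2 : ℕ) - q'.2) = a := by nlinarith
        rcases ha with rfl | rfl
        · refine ⟨0, Or.inl ?_⟩
          have : ((q.1 : ℕ) : ℝ) + q.2 - (q'.1 + q'.2) = 1 := by linarith
          exact_mod_cast this
        · refine ⟨0, Or.inr ?_⟩
          have : ((q.1 : ℕ) : ℝ) + q.2 - (q'.1 + q'.2) = -1 := by linarith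
          exact_mod_cast this
    obtain ⟨k, hk⟩ := hsum
    unfold roofPat
    rw [Nat.even_iff, Nat.even_iff]
    omega
  -- apply with the sector's signs: `cU - cL = Rz j (0, 2ℓ)`
  obtain ⟨σ₁, σ₂, h₁, h₂, hR⟩ := exists_isSign_Rz j 1 (Or.inl rfl)
  have hdiff : P.gr.centre (P.qL hv hvb j) - P.gr.centre (P.qU hv hvb j) = -(Rz j (0, 2 * P.gr.ℓ)) := by
    rw [hU, hL, show v + Rz j (P.gr.ℓ, -P.gr.ℓ) - (v + Rz j (P.gr.ℓ, P.gr.ℓ)) = Rz j (P.gr.ℓ, -P.gr.ℓ) - Rz j (P.gr.ℓ, P.gr.ℓ) by abel,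
      ← map_sub, ← map_neg]
    congr 1
    ext <;> simp; ring
  -- `Rz j (0, 2ℓ) = Rz j ((1,1) ℓ - (1,-1) ℓ)`: in terms of `(σ₁, σ₂) = Rz j (1,1)` and `Rz j (1,-1) = Rz j (R⁻¹ ...)`;
  -- simpler: `Rz j (0, 2ℓ) = 2ℓ • Rz j (0, 1)` and `Rz j (0,1) = Rz j (R (1, 0))`... we just case on `j`.
  have hR01 : ∃ a b : ℝ, IsSign a ∧ (b = 0) ∧
      (Rz j (0, 2 * P.gr.ℓ) = (b, a * (2 * P.gr.ℓ)) ∨ Rz j (0, 2 * P.gr.ℓ) = (a * (2 * P.gr.ℓ), b)) := by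
    fin_cases j
    · exact ⟨1, 0, Or.inl rfl, rfl, Or.inl (by show Rz 0 _ = _; rw [Rz_zero]; simp)⟩
    · exact ⟨-1, 0, Or.inr rfl, rfl, Or.inr (by show Rz 1 _ = _; rw [Rz_one]; simp)⟩
    · exact ⟨-1, 0, Or.inr rfl, rfl, Or.inl (by show Rz 2 _ = _; rw [Rz_two]; simp)⟩
    · exact ⟨1, 0, Or.inl rfl, rfl, Or.inr (by show Rz 3 _ = _; rw [Rz_three]; simp)⟩
  obtain ⟨a, b, ha, rfl, hab⟩ := hR01
  have ha' : IsSign (-a) := by rcases ha with rfl | rfl; exacts [Or.inr rfl, Or.inl (by norm_num)]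
  rcases hab with hab | hab
  · -- vertical difference: `centre qL - centre qU = (0, -a 2ℓ)` : use `key` with `(a', b') = (-a, ... )`:
    -- `(0, -2aℓ) = (a'ℓ - b'ℓ, a'ℓ + b'ℓ)` with `a' = -a`, `b' = -a`
    refine key _ _ (-a) (-a) ha' ha' (Or.inr ?_)
    rw [hdiff, hab]
    ext <;> simp; ring
  · -- horizontal difference `(-2aℓ, 0) = (a'ℓ + b'ℓ, a'ℓ - b'ℓ)` with `a' = b' = -a`
    refine key _ _ (-a) (-a) ha' ha' (Or.inl ?_)
    rw [hdiff, hab]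
    ext <;> simp; ring

omit [NormedSpace ℝ B] in
/-- **The signs alternate.** [folklore] -/
theorem sgn_add_one (j : ZMod 4) : P.sgn hv hvb (j + 1) = -P.sgn hv hvb j := by
  classical
  have h := P.roofPat_qL_iff hv hvb (j + 1)
  rw [P.qL_add_one hv hvb j] at h
  -- `h : roofPat (qU j) ↔ ¬ roofPat (qU (j + 1))`
  unfold sgn
  by_cases hr : P.roofPat (P.qU hv hvb j)
  · have h' : ¬ P.roofPat (P.qU hv hvb (j + 1)) := h.1 hr
    rw [if_neg h', if_pos hr]
  · have h' : P.roofPat (P.qU hv hvb (j + 1)) := by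
      by_contra h''
      exact hr (h.2 h'')
    rw [if_pos h', if_neg hr]; norm_num

omit [NormedSpace ℝ B] in
/-- The edge point of abscissa `b ∈ [0, ℓ]` of the sector `j` is on the boundary of the upper
square. [folklore] -/
theorem ept_mem_sphere_qU (j : ZMod 4) {b : ℝ} (hb : b ∈ Icc 0 P.gr.ℓ) :
    ept v j b ∈ sphere (P.gr.centre (P.qU hv hvb j)) P.gr.ℓ := by
  have hℓ := P.gr.hℓ
  rw [centre_qU, cU, ept, mem_sphere, dist_vadd_Rz, Prod.dist_eq, Real.dist_eq, Real.dist_eq, zero_sub, abs_neg,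
    abs_of_pos hℓ, show b - P.gr.ℓ = -(P.gr.ℓ - b) by ring, abs_neg, abs_of_nonneg (by linarith [hb.2])]
  exact max_eq_right (by linarith [hb.1])

omit [NormedSpace ℝ B] in
/-- The edge point is on the boundary of the lower square. [folklore] -/
theorem ept_mem_sphere_qL (j : ZMod 4) {b : ℝ} (hb : b ∈ Icc 0 P.gr.ℓ) :
    ept v j b ∈ sphere (P.gr.centre (P.qL hv hvb j)) P.gr.ℓ := by
  have hℓ := P.gr.hℓ
  rw [centre_qL, cL, ept, mem_sphere, dist_vadd_Rz, Prod.dist_eq, Real.dist_eq, Real.dist_eq,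
    show (0 : ℝ) - -P.gr.ℓ = P.gr.ℓ by ring, abs_of_pos hℓ, show b - P.gr.ℓ = -(P.gr.ℓ - b) by ring, abs_neg,
    abs_of_nonneg (by linarith [hb.2])]
  exact max_eq_right (by linarith [hb.1])

omit [NormedSpace ℝ B] in
/-- Gluing strict monotonicity on two adjacent closed intervals. [folklore] -/
theorem strictMonoOn_Icc_union {g : ℝ → ℝ} {a b c : ℝ} (h₁ : StrictMonoOn g (Icc a b)) (h₂ : StrictMonoOn g (Icc b c)) :
    StrictMonoOn g (Icc a c) := by
  intro t₁ ht₁ t₂ ht₂ hlt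
  by_cases hb₁ : t₁ ≤ b
  · by_cases hb₂ : t₂ ≤ b
    · exact h₁ ⟨ht₁.1, hb₁⟩ ⟨ht₂.1, hb₂⟩ hlt
    · push Not at hb₂
      rcases hb₁.eq_or_lt with rfl | hlt₁
      · exact h₂ ⟨le_rfl, ht₁.2⟩ ⟨hb₂.le, ht₂.2⟩ hlt
      · have hab : a ≤ b := ht₁.1.trans hb₁
        exact (h₁ ⟨ht₁.1, hb₁⟩ ⟨hab, le_rfl⟩ hlt₁).trans (h₂ ⟨le_rfl, hb₂.le.trans ht₂.2⟩ ⟨hb₂.le, ht₂.2⟩ hb₂)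
  · push Not at hb₁
    exact h₂ ⟨hb₁.le, ht₁.2⟩ ⟨(hb₁.trans hlt).le, ht₂.2⟩ hlt

/-- **Strict monotonicity of the common height along the broken rays.** With `r` a vertex
radius, `b ∈ [0, ℓ]`, `0 ≤ u < ℓ`, `b + u ≤ r`: `t ↦ Hv (spt v ℓ j (sgn j) (b, t))` is strictly
increasing on `[-u, u]`. [folklore] -/
theorem strictMonoOn_Hv_spt {r : ℝ}
    (hr : ∀ j, (∀ z ∈ closedBall v r ∩ P.gr.sq (P.qU hv hvb j), ∀ z' ∈ closedBall v r ∩ P.gr.sq (P.qU hv hvb j),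
          (height (P.box (P.qU hv hvb j)) (P.fill P.apex z) < height (P.box (P.qU hv hvb j)) (P.fill P.apex z') ↔
            P.Hv hv hvb z < P.Hv hv hvb z')) ∧
        (∀ z ∈ closedBall v r ∩ P.gr.sq (P.qL hv hvb j), ∀ z' ∈ closedBall v r ∩ P.gr.sq (P.qL hv hvb j),
          (height (P.box (P.qL hv hvb j)) (P.fill P.apex z) < height (P.box (P.qL hv hvb j)) (P.fill P.apex z') ↔
            P.Hv hv hvb z < P.Hv hv hvb z')))
    (j : ZMod 4) {b u : ℝ} (hb : b ∈ Icc 0 P.gr.ℓ) (hu : u ∈ Ico 0 P.gr.ℓ) (hbu : b + u ≤ r) :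
    StrictMonoOn (fun t ↦ P.Hv hv hvb (spt v P.gr.ℓ j (P.sgn hv hvb j) (b, t))) (Icc (-u) u) := by
  classical
  have hℓ := P.gr.hℓ
  set s := P.sgn hv hvb j with hs
  have hsg : IsSg s := P.isSg_sgn hv hvb j
  set qU := P.qU hv hvb j with hqU
  set qL := P.qL hv hvb j with hqL
  obtain ⟨hrU, hrL⟩ := hr j
  -- membership facts
  have hball : ∀ t ∈ Icc (-u) u, spt v P.gr.ℓ j s (b, t) ∈ closedBall v r := fun t ht ↦ by
    rw [mem_closedBall]
    have h := dist_spt_le (v := v) hℓ j hsg (u := t) hb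
    have : |t| ≤ u := abs_le.2 ⟨ht.1, ht.2⟩
    linarith
  have hmemU : ∀ t, s * t ∈ Ico 0 P.gr.ℓ → spt v P.gr.ℓ j s (b, t) ∈ P.gr.sq qU := fun t hst ↦ by
    rw [hqU, Grid.sq, centre_qU]; exact spt_mem_closedBall_upper hℓ j hb hst
  have hmemL : ∀ t, s * t ∈ Ioc (-P.gr.ℓ) 0 → spt v P.gr.ℓ j s (b, t) ∈ P.gr.sq qL := fun t hst ↦ by
    rw [hqL, Grid.sq, centre_qL]; exact spt_mem_closedBall_lower hℓ j hb hst
  -- cone heights along the broken ray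
  have heptU := P.ept_mem_sphere_qU hv hvb j hb
  have heptL := P.ept_mem_sphere_qL hv hvb j hb
  have hconeU : ∀ t, s * t ∈ Ico 0 P.gr.ℓ →
      height (P.box qU) (P.fill P.apex (spt v P.gr.ℓ j s (b, t))) =
        P.bdryHt qU (ept v j b) + (P.apex qU - P.bdryHt qU (ept v j b)) * (s * t) / P.gr.ℓ := fun t hst ↦ by
    rw [P.height_fill_eq_coneHt (hmemU t hst), hqU, centre_qU]
    exact coneHt_spt_upper hℓ j _ _ hb hst
  have hconeL : ∀ t, s * t ∈ Ioc (-P.gr.ℓ) 0 →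
      height (P.box qL) (P.fill P.apex (spt v P.gr.ℓ j s (b, t))) =
        P.bdryHt qL (ept v j b) + (P.apex qL - P.bdryHt qL (ept v j b)) * (-(s * t)) / P.gr.ℓ := fun t hst ↦ by
    rw [P.height_fill_eq_coneHt (hmemL t hst), hqL, centre_qL]
    exact coneHt_spt_lower hℓ j _ _ hb hst
  -- the pattern: `s = 1 ↔ qU roof`, and `qL` has the opposite pattern
  have hpat : (P.roofPat qU ∧ s = 1) ∨ (¬ P.roofPat qU ∧ s = -1) := by
    by_cases h : P.roofPat qU
    · exact Or.inl ⟨h, by rw [hs, sgn, if_pos h]⟩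
    · exact Or.inr ⟨h, by rw [hs, sgn, if_neg h]⟩
  have hpatL : P.roofPat qL ↔ ¬ P.roofPat qU := P.roofPat_qL_iff hv hvb j
  -- monotonicity on `[0, u]` and on `[-u, 0]`
  have hu' : ∀ t ∈ Icc (-u) u, |t| < P.gr.ℓ := fun t ht ↦ (abs_le.2 ⟨ht.1, ht.2⟩).trans_lt hu.2
  have key_pos : StrictMonoOn (fun t ↦ P.Hv hv hvb (spt v P.gr.ℓ j s (b, t))) (Icc 0 u) := by
    intro t₁ ht₁ t₂ ht₂ hlt
    have ht₁' : t₁ ∈ Icc (-u) u := ⟨by linarith [ht₁.1, hu.1], ht₁.2⟩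
    have ht₂' : t₂ ∈ Icc (-u) u := ⟨by linarith [ht₂.1, hu.1], ht₂.2⟩
    rcases hpat with ⟨hroof, hs1⟩ | ⟨hfloor, hs1⟩
    · -- upper square, roof: heights `ψ + (m - ψ) t / ℓ` increase
      have hst₁ : s * t₁ ∈ Ico 0 P.gr.ℓ := by rw [hs1, one_mul]; exact ⟨ht₁.1, (le_abs_self t₁).trans_lt (hu' t₁ ht₁')⟩
      have hst₂ : s * t₂ ∈ Ico 0 P.gr.ℓ := by rw [hs1, one_mul]; exact ⟨ht₂.1, (le_abs_self t₂).trans_lt (hu' t₂ ht₂')⟩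
      refine (hrU _ ⟨hball t₁ ht₁', hmemU t₁ hst₁⟩ _ ⟨hball t₂ ht₂', hmemU t₂ hst₂⟩).1 ?_
      rw [hconeU t₁ hst₁, hconeU t₂ hst₂, hs1, one_mul, one_mul]
      have hm : P.bdryHt qU (ept v j b) < P.apex qU := P.apex_spec.2.1 qU hroof _ heptU
      have : (P.apex qU - P.bdryHt qU (ept v j b)) * t₁ / P.gr.ℓ < (P.apex qU - P.bdryHt qU (ept v j b)) * t₂ / P.gr.ℓ :=
        div_lt_div_of_pos_right (mul_lt_mul_of_pos_left hlt (by linarith)) hℓ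
      linarith
    · -- lower square, roof (since `qU` is floor): heights `ψ_L + (m_L - ψ_L) t / ℓ` increase
      have hroofL : P.roofPat qL := hpatL.2 hfloor
      have hst₁ : s * t₁ ∈ Ioc (-P.gr.ℓ) 0 := by
        rw [hs1, neg_one_mul]; exact ⟨by linarith [(neg_abs_le t₁), hu' t₁ ht₁', le_abs_self t₁], by linarith [ht₁.1]⟩
      have hst₂ : s * t₂ ∈ Ioc (-P.gr.ℓ) 0 := by
        rw [hs1, neg_one_mul]; exact ⟨by linarith [(neg_abs_le t₂), hu' t₂ ht₂', le_abs_self t₂], by linarith [ht₂.1]⟩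
      refine (hrL _ ⟨hball t₁ ht₁', hmemL t₁ hst₁⟩ _ ⟨hball t₂ ht₂', hmemL t₂ hst₂⟩).1 ?_
      rw [hconeL t₁ hst₁, hconeL t₂ hst₂, hs1, neg_one_mul, neg_one_mul, neg_neg, neg_neg]
      have hm : P.bdryHt qL (ept v j b) < P.apex qL := P.apex_spec.2.1 qL hroofL _ heptL
      have : (P.apex qL - P.bdryHt qL (ept v j b)) * t₁ / P.gr.ℓ < (P.apex qL - P.bdryHt qL (ept v j b)) * t₂ / P.gr.ℓ :=
        div_lt_div_of_pos_right (mul_lt_mul_of_pos_left hlt (by linarith)) hℓ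
      linarith
  have key_neg : StrictMonoOn (fun t ↦ P.Hv hv hvb (spt v P.gr.ℓ j s (b, t))) (Icc (-u) 0) := by
    intro t₁ ht₁ t₂ ht₂ hlt
    have ht₁' : t₁ ∈ Icc (-u) u := ⟨ht₁.1, by linarith [ht₁.2, hu.1]⟩
    have ht₂' : t₂ ∈ Icc (-u) u := ⟨ht₂.1, by linarith [ht₂.2, hu.1]⟩
    rcases hpat with ⟨hroof, hs1⟩ | ⟨hfloor, hs1⟩
    · -- lower square, floor (since `qU` roof): heights `ψ_L + (m_L - ψ_L)(-t)/ℓ`, `m_L < ψ_L`, increase in `t`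
      have hfloorL : ¬ P.roofPat qL := fun h ↦ (hpatL.1 h) hroof
      have hst₁ : s * t₁ ∈ Ioc (-P.gr.ℓ) 0 := by
        rw [hs1, one_mul]; exact ⟨by linarith [neg_abs_le t₁, hu' t₁ ht₁'], ht₁.2⟩
      have hst₂ : s * t₂ ∈ Ioc (-P.gr.ℓ) 0 := by
        rw [hs1, one_mul]; exact ⟨by linarith [neg_abs_le t₂, hu' t₂ ht₂'], ht₂.2⟩
      refine (hrL _ ⟨hball t₁ ht₁', hmemL t₁ hst₁⟩ _ ⟨hball t₂ ht₂', hmemL t₂ hst₂⟩).1 ?_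
      rw [hconeL t₁ hst₁, hconeL t₂ hst₂, hs1, one_mul, one_mul]
      have hm : P.apex qL < P.bdryHt qL (ept v j b) := P.apex_spec.2.2 qL hfloorL _ heptL
      have : (P.apex qL - P.bdryHt qL (ept v j b)) * (-t₁) / P.gr.ℓ < (P.apex qL - P.bdryHt qL (ept v j b)) * (-t₂) / P.gr.ℓ :=
        div_lt_div_of_pos_right (mul_lt_mul_of_neg_left (by linarith) (by linarith)) hℓ
      linarith
    · -- upper square, floor: heights `ψ_U + (m_U - ψ_U)(-t)/ℓ`, `m_U < ψ_U`, increase in `t`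
      have hst₁ : s * t₁ ∈ Ico 0 P.gr.ℓ := by
        rw [hs1, neg_one_mul]; exact ⟨by linarith [ht₁.2], by linarith [le_abs_self t₁, neg_abs_le t₁, hu' t₁ ht₁']⟩
      have hst₂ : s * t₂ ∈ Ico 0 P.gr.ℓ := by
        rw [hs1, neg_one_mul]; exact ⟨by linarith [ht₂.2], by linarith [le_abs_self t₂, neg_abs_le t₂, hu' t₂ ht₂']⟩
      refine (hrU _ ⟨hball t₁ ht₁', hmemU t₁ hst₁⟩ _ ⟨hball t₂ ht₂', hmemU t₂ hst₂⟩).1 ?_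
      rw [hconeU t₁ hst₁, hconeU t₂ hst₂, hs1, neg_one_mul, neg_one_mul]
      have hm : P.apex qU < P.bdryHt qU (ept v j b) := P.apex_spec.2.2 qU hfloor _ heptU
      have : (P.apex qU - P.bdryHt qU (ept v j b)) * (-t₁) / P.gr.ℓ < (P.apex qU - P.bdryHt qU (ept v j b)) * (-t₂) / P.gr.ℓ :=
        div_lt_div_of_pos_right (mul_lt_mul_of_neg_left (by linarith) (by linarith)) hℓ
      linarith
  exact strictMonoOn_Icc_union key_neg key_pos

/-- **Signs on the half axes**: under the hypotheses of `strictMonoOn_Hv_spt` with `b = 0`, the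
common height is positive at `spt (0, t)` for `0 < t ≤ u` and negative for `-u ≤ t < 0`.
[folklore] -/
theorem Hv_spt_axis_sign {r : ℝ}
    (hr : ∀ j, (∀ z ∈ closedBall v r ∩ P.gr.sq (P.qU hv hvb j), ∀ z' ∈ closedBall v r ∩ P.gr.sq (P.qU hv hvb j),
          (height (P.box (P.qU hv hvb j)) (P.fill P.apex z) < height (P.box (P.qU hv hvb j)) (P.fill P.apex z') ↔
            P.Hv hv hvb z < P.Hv hv hvb z')) ∧
        (∀ z ∈ closedBall v r ∩ P.gr.sq (P.qL hv hvb j), ∀ z' ∈ closedBall v r ∩ P.gr.sq (P.qL hv hvb j),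
          (height (P.box (P.qL hv hvb j)) (P.fill P.apex z) < height (P.box (P.qL hv hvb j)) (P.fill P.apex z') ↔
            P.Hv hv hvb z < P.Hv hv hvb z')))
    (j : ZMod 4) {u : ℝ} (hu : u ∈ Ico 0 P.gr.ℓ) (hur : u ≤ r) {t : ℝ} (ht : t ∈ Icc (-u) u) :
    (0 < t → 0 < P.Hv hv hvb (spt v P.gr.ℓ j (P.sgn hv hvb j) (0, t))) ∧
      (t < 0 → P.Hv hv hvb (spt v P.gr.ℓ j (P.sgn hv hvb j) (0, t)) < 0) := by
  have hℓ := P.gr.hℓ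
  have hmono := P.strictMonoOn_Hv_spt hv hvb hr j (b := 0) ⟨le_rfl, hℓ.le⟩ hu (by linarith)
  have h0 : (0 : ℝ) ∈ Icc (-u) u := ⟨by linarith [hu.1], hu.1⟩
  have hv0 : P.Hv hv hvb (spt v P.gr.ℓ j (P.sgn hv hvb j) (0, 0)) = 0 := by
    rw [show ((0 : ℝ), (0 : ℝ)) = (0 : ℝ × ℝ) from rfl, spt_zero, Hv_self]
  constructor
  · intro htpos
    have := hmono h0 ht htpos
    simp only at this
    rwa [hv0] at this
  · intro htneg
    have := hmono ht h0 htneg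
    simp only at this
    rwa [hv0] at this

end Foliation.ConePosition

end Literature.Topology.FourManifolds
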